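import Mathlib
import HarnessLib

/-!
# Lindström's theorem: every family of `n + 2` subsets of an `n`-set is balanced

S. Jukna, *Extremal Combinatorics — with applications in computer science* (1st ed., Springer 2001)
[Jukna2001], Chapter 15 "Orthogonality and rank arguments", §15.2.1 "Balanced families",
Theorem 15.9 (Lindström 1993) with the proof printed there; original: B. Lindström,
*Another theorem on families of sets*, Ars Combinatoria 35 (1993) 123–124 [Lindstrom1993].

A family `A_1, …, A_m` of distinct sets is *balanced* if there exist two disjoint non-empty sets of
indices `I` and `J` such that `⋃_{i ∈ I} A_i = ⋃_{j ∈ J} A_j` and `⋂_{i ∈ I} A_i = ⋂_{j ∈ J} A_j`.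
**Theorem 15.9 (Lindström 1993).** Every family of `m ≥ n + 2` distinct subsets of an `n`-element
set is balanced.

Printed proof: the incidence vectors of the pairs `(A, Ā)` lie in a space of dimension `n + 1`, so
`m ≥ n + 2` of them satisfy a nontrivial relation, written with positive coefficients as
`Σ_{i ∈ I} α_i v_i = Σ_{j ∈ J} β_j v_j`; this forces `⋃_I A_i = ⋃_J A_j` and `⋃_I Ā_i = ⋃_J Ā_j`,
the latter being `⋂_I A_i = ⋂_J A_j`.

PROVED here (theorems only, no named facts): we use the vectors `(χ_A, 1) ∈ ℚ^{n+1}` (coordinates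
`Option α`), which carry the same information as `(χ_A, χ_Ā)` (the extra coordinate records
`Σ α_i = Σ β_j`); `I` and `J` are the members with positive, resp. negative, coefficient.
* `exists_neg_of_sum_mul_indicator_eq_zero` — the sign argument: if `Σ_i λ_i c_i = 0` with
  `c_i ∈ {0,1}` and some `λ_i > 0` has `c_i = 1`, then some `λ_j < 0` has `c_j = 1`;
* **`lindstrom_balanced`** — Theorem 15.9 with the union and intersection conditions spelled out
  elementwise; **`lindstrom_balanced_sup_inf`** — the same with `Finset.sup id` (union) and
  `Finset.inf' _ id` (intersection).

## References

* [Jukna2001] S. Jukna, *Extremal Combinatorics*, 1st ed., Springer (2001), Theorem 15.9 and its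
  proof (held text `book:jukna2011-extremal-combinatorics-with-applications-computer-science`,
  chunks 195–196).
* [Lindstrom1993] B. Lindström, Ars Combinatoria 35 (1993) 123–124.
-/

namespace Literature.Combinatorics.SetFamily

open Finset

variable {α : Type*} [DecidableEq α]

/-- The sign argument of the printed proof: if `Σ_i λ_i c_i = 0` with all `c_i ∈ {0,1}`, and some
index with `λ_i > 0` has `c_i = 1`, then some index with `λ_j < 0` has `c_j = 1` (a vanishing sum of
reals cannot have a positive term and no negative one). [cite: Jukna2001, Ch. 15 §15.2.1, proof of
Theorem 15.9 ("`α_i, β_j > 0` … But this means that `⋃_I A_i = ⋃_J A_j`")] -/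
theorem exists_neg_of_sum_mul_indicator_eq_zero {ι : Type*} (s : Finset ι) (g : ι → ℚ)
    (c : ι → Prop) [DecidablePred c]
    (hsum : ∑ i ∈ s, g i * (if c i then 1 else 0) = 0) {i₀ : ι} (hi₀ : i₀ ∈ s) (hg₀ : 0 < g i₀)
    (hc₀ : c i₀) : ∃ j ∈ s, g j < 0 ∧ c j := by
  by_contra hno
  push Not at hno
  -- then every term is nonnegative, so all vanish — but the `i₀` term is positive
  have hnonneg : ∀ i ∈ s, 0 ≤ g i * (if c i then 1 else 0) := by
    intro i hi
    by_cases hc : c i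
    · rw [if_pos hc, mul_one]
      by_contra hlt
      push Not at hlt
      exact hno i hi hlt hc
    · rw [if_neg hc, mul_zero]
  have h0 := (Finset.sum_eq_zero_iff_of_nonneg hnonneg).mp hsum i₀ hi₀
  rw [if_pos hc₀, mul_one] at h0
  exact hg₀.ne' h0

/-- **Theorem 15.9 (Lindström 1993).** Every family `𝓕` of at least `n + 2` distinct subsets of an
`n`-element set is balanced: there are disjoint nonempty subfamilies `I, J ⊆ 𝓕` with
`⋃ I = ⋃ J` and `⋂ I = ⋂ J` (both conditions elementwise). [cite: Jukna2001, Ch. 15 §15.2.1,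
Theorem 15.9; Lindstrom1993] -/
theorem lindstrom_balanced [Fintype α] (𝓕 : Finset (Finset α))
    (h𝓕 : Fintype.card α + 2 ≤ 𝓕.card) :
    ∃ I J : Finset (Finset α), I ⊆ 𝓕 ∧ J ⊆ 𝓕 ∧ I.Nonempty ∧ J.Nonempty ∧ Disjoint I J ∧
      (∀ x : α, (∃ A ∈ I, x ∈ A) ↔ (∃ A ∈ J, x ∈ A)) ∧
      (∀ x : α, (∀ A ∈ I, x ∈ A) ↔ (∀ A ∈ J, x ∈ A)) := by
  classical
  -- the vectors `(χ_A, 1) ∈ ℚ^{n+1}`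
  set w : 𝓕 → (Option α → ℚ) := fun A o =>
    Option.elim o 1 (fun a => if a ∈ (A : Finset α) then 1 else 0) with hw
  -- `n + 2 > n + 1 = dim`: a nontrivial relation
  have hdep : ¬ LinearIndependent ℚ w := by
    intro hli
    have h := hli.fintype_card_le_finrank
    rw [Module.finrank_fintype_fun_eq_card, Fintype.card_coe, Fintype.card_option] at h
    omega
  obtain ⟨g, hrel, A₀, hA₀⟩ := Fintype.not_linearIndependent_iff.mp hdep
  -- the coordinates of the relation
  have hcoord : ∀ o : Option α, ∑ A, g A * w A o = 0 := fun o => by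
    simpa only [Finset.sum_apply, Pi.smul_apply, smul_eq_mul, Pi.zero_apply] using congrFun hrel o
  have hsum1 : ∑ A, g A = 0 := by simpa [hw] using hcoord none
  have hsumx : ∀ x : α, ∑ A, g A * (if x ∈ (A : Finset α) then (1 : ℚ) else 0) = 0 := fun x => by
    simpa [hw] using hcoord (some x)
  -- also `Σ λ_A [x ∉ A] = 0`
  have hsumx' : ∀ x : α, ∑ A, g A * (if x ∉ (A : Finset α) then (1 : ℚ) else 0) = 0 := by
    intro x
    have h : ∀ A : 𝓕, g A * (if x ∉ (A : Finset α) then (1 : ℚ) else 0) =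
        g A - g A * (if x ∈ (A : Finset α) then (1 : ℚ) else 0) := by
      intro A; by_cases hx : x ∈ (A : Finset α) <;> simp [hx]
    rw [Finset.sum_congr rfl (fun A _ => h A), Finset.sum_sub_distrib, hsum1, hsumx, sub_zero]
  -- `I` = positive coefficients, `J` = negative coefficients
  set I : Finset (Finset α) := (Finset.univ.filter (fun A : 𝓕 => 0 < g A)).image Subtype.val
    with hI
  set J : Finset (Finset α) := (Finset.univ.filter (fun A : 𝓕 => g A < 0)).image Subtype.val
    with hJ
  have memI : ∀ A : Finset α, A ∈ I ↔ ∃ h : A ∈ 𝓕, 0 < g ⟨A, h⟩ := by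
    intro A
    simp only [hI, Finset.mem_image, Finset.mem_filter, Finset.mem_univ, true_and]
    constructor
    · rintro ⟨⟨A', hA'⟩, hg, rfl⟩; exact ⟨hA', hg⟩
    · rintro ⟨hA, hg⟩; exact ⟨⟨A, hA⟩, hg, rfl⟩
  have memJ : ∀ A : Finset α, A ∈ J ↔ ∃ h : A ∈ 𝓕, g ⟨A, h⟩ < 0 := by
    intro A
    simp only [hJ, Finset.mem_image, Finset.mem_filter, Finset.mem_univ, true_and]
    constructor
    · rintro ⟨⟨A', hA'⟩, hg, rfl⟩; exact ⟨hA', hg⟩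
    · rintro ⟨hA, hg⟩; exact ⟨⟨A, hA⟩, hg, rfl⟩
  -- both signs occur
  have hpos : ∃ A : 𝓕, 0 < g A := by
    obtain ⟨A, -, hA⟩ := Finset.exists_pos_of_sum_zero_of_exists_nonzero g hsum1
      ⟨A₀, Finset.mem_univ _, hA₀⟩
    exact ⟨A, hA⟩
  have hneg : ∃ A : 𝓕, g A < 0 := by
    have hsum1' : ∑ A, (-g) A = 0 := by
      simp only [Pi.neg_apply, Finset.sum_neg_distrib, hsum1, neg_zero]
    obtain ⟨A, -, hA⟩ := Finset.exists_pos_of_sum_zero_of_exists_nonzero (-g) hsum1'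
      ⟨A₀, Finset.mem_univ _, by simpa using hA₀⟩
    exact ⟨A, by simpa using hA⟩
  refine ⟨I, J, ?_, ?_, ?_, ?_, ?_, ?_, ?_⟩
  · intro A hA; obtain ⟨h, -⟩ := (memI A).mp hA; exact h
  · intro A hA; obtain ⟨h, -⟩ := (memJ A).mp hA; exact h
  · obtain ⟨A, hA⟩ := hpos; exact ⟨A.1, (memI A.1).mpr ⟨A.2, hA⟩⟩
  · obtain ⟨A, hA⟩ := hneg; exact ⟨A.1, (memJ A.1).mpr ⟨A.2, hA⟩⟩
  · rw [Finset.disjoint_left]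
    intro A hAI hAJ
    obtain ⟨h1, hg1⟩ := (memI A).mp hAI
    obtain ⟨h2, hg2⟩ := (memJ A).mp hAJ
    exact lt_asymm hg1 hg2
  · -- unions: `x` lies in a positive member iff it lies in a negative member
    intro x
    constructor
    · rintro ⟨A, hAI, hxA⟩
      obtain ⟨hA, hgA⟩ := (memI A).mp hAI
      obtain ⟨B, -, hgB, hxB⟩ := exists_neg_of_sum_mul_indicator_eq_zero Finset.univ g
        (fun B : 𝓕 => x ∈ (B : Finset α)) (hsumx x) (Finset.mem_univ ⟨A, hA⟩) hgA hxA
      exact ⟨B.1, (memJ B.1).mpr ⟨B.2, hgB⟩, hxB⟩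
    · rintro ⟨A, hAJ, hxA⟩
      obtain ⟨hA, hgA⟩ := (memJ A).mp hAJ
      have hsumx_neg : ∑ B, (-g) B * (if x ∈ (B : Finset α) then (1 : ℚ) else 0) = 0 := by
        simp only [Pi.neg_apply, neg_mul, Finset.sum_neg_distrib, hsumx x, neg_zero]
      obtain ⟨B, -, hgB, hxB⟩ := exists_neg_of_sum_mul_indicator_eq_zero Finset.univ (-g)
        (fun B : 𝓕 => x ∈ (B : Finset α)) hsumx_neg (Finset.mem_univ ⟨A, hA⟩)
        (by simpa using hgA) hxA
      exact ⟨B.1, (memI B.1).mpr ⟨B.2, by simpa using hgB⟩, hxB⟩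
  · -- intersections: the same argument with `[x ∉ A]`
    intro x
    rw [← not_iff_not]
    push Not
    constructor
    · rintro ⟨A, hAI, hxA⟩
      obtain ⟨hA, hgA⟩ := (memI A).mp hAI
      obtain ⟨B, -, hgB, hxB⟩ := exists_neg_of_sum_mul_indicator_eq_zero Finset.univ g
        (fun B : 𝓕 => x ∉ (B : Finset α)) (hsumx' x) (Finset.mem_univ ⟨A, hA⟩) hgA hxA
      exact ⟨B.1, (memJ B.1).mpr ⟨B.2, hgB⟩, hxB⟩
    · rintro ⟨A, hAJ, hxA⟩
      obtain ⟨hA, hgA⟩ := (memJ A).mp hAJ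
      have hsumx_neg : ∑ B, (-g) B * (if x ∉ (B : Finset α) then (1 : ℚ) else 0) = 0 := by
        simp only [Pi.neg_apply, neg_mul, Finset.sum_neg_distrib, hsumx' x, neg_zero]
      obtain ⟨B, -, hgB, hxB⟩ := exists_neg_of_sum_mul_indicator_eq_zero Finset.univ (-g)
        (fun B : 𝓕 => x ∉ (B : Finset α)) hsumx_neg (Finset.mem_univ ⟨A, hA⟩)
        (by simpa using hgA) hxA
      exact ⟨B.1, (memI B.1).mpr ⟨B.2, by simpa using hgB⟩, hxB⟩

/-- **Theorem 15.9 (Lindström 1993), lattice form:** disjoint nonempty subfamilies `I, J ⊆ 𝓕`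
with `⋃ I = ⋃ J` (`Finset.sup id`) and `⋂ I = ⋂ J` (`Finset.inf' _ id`).
[cite: Jukna2001, Ch. 15 §15.2.1, Theorem 15.9; Lindstrom1993] -/
theorem lindstrom_balanced_sup_inf [Fintype α] (𝓕 : Finset (Finset α))
    (h𝓕 : Fintype.card α + 2 ≤ 𝓕.card) :
    ∃ I J : Finset (Finset α), ∃ hI : I.Nonempty, ∃ hJ : J.Nonempty,
      I ⊆ 𝓕 ∧ J ⊆ 𝓕 ∧ Disjoint I J ∧ I.sup id = J.sup id ∧ I.inf' hI id = J.inf' hJ id := by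
  obtain ⟨I, J, hI𝓕, hJ𝓕, hI, hJ, hdisj, hU, hInt⟩ := lindstrom_balanced 𝓕 h𝓕
  refine ⟨I, J, hI, hJ, hI𝓕, hJ𝓕, hdisj, ?_, ?_⟩
  · ext x
    simp only [Finset.mem_sup, id_eq]
    exact hU x
  · ext x
    simp only [Finset.mem_inf', id_eq]
    exact hInt x

end Literature.Combinatorics.SetFamily
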